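import Summits.KontsevichZagierPeriods.KontsevichZagierPeriods.Theorems.CobordismMoveZeroCombination
import Literature.NumberTheory.Transcendental.KZDominatedFamilyRelations
import Literature.NumberTheory.Transcendental.SemialgebraicLineDeriv
import Literature.NumberTheory.Transcendental.SemialgebraicVolume
import Literature.ModelTheory.ExponentialFields.SemialgebraicInterior
import Summits.KontsevichZagierPeriods.KontsevichZagierPeriods.Theses.MultivaluedCoV
import Mathlib.MeasureTheory.Function.Jacobian

/-!
# `SignedSheetTransfer` (stmt-KontsevichZagierPeriods-5567, route CobordismMove) — PROVED

Sorry-free proof of the route declaration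
`Summit.KontsevichZagierPeriods.KontsevichZagierPeriods.Theses.CobordismMove.SignedSheetTransfer`
(theorem `signedSheetTransfer_proof`, concluding it BY NAME), obtained by proving all six registered
stubs of the strategist line `split` (`Cruxes/SignedSheetTransfer/Lines/split.lean`) and composing
them through the typed decomposition

  `SignedSheetTransfer ⇐ SignedSheetPushforward (X₁) ∧ SignedCountRegroup (X₂)`

(`signedSheetTransfer_of_subs`, `signedSheetPushforward_of`, `signedCountRegroup_of`).

* X₁ `SignedSheetPushforward` — MULTI-SHEET PUSHFORWARD with integer weights and no multiplicity
  hypothesis: `[r] − Σ_k c_k • [Φ_k σ_k, g_k] ∈ KZ.relations`. Proof: shrink the sheets to the open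
  `ℚ`-semialgebraic pieces `V_k = interior σ_k ∖ ⋃_j ∂σ_j` (the bad set is closed and null,
  `volume_frontier_eq_zero_of_isSemialgebraic`), on which the within-derivative data `Φ'_k` IS the
  Fréchet derivative, so `|det Φ'_k|` is `ℚ`-semialgebraic (`stub_jacobianSemialgebraic`: partials by
  `IsSemialgebraicFunOn.fderiv_apply_single`, Leibniz by `IsSemialgebraicFunOn.matrix_det`); push each
  zero-extended sheet term forward by ONE instance of rule (2) (`stub_singleSheetPush`), drop the null
  images `Φ_k(σ_k ∖ V_k)` (`stub_imageNullRestrict`, Mathlib's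
  `addHaar_image_eq_zero_of_differentiableOn_of_addHaar_eq_zero`), and collect with the landed
  `ZeroCombination.zeroCombination_holds`.
* X₂ `SignedCountRegroup` — CONSTANT SIGNED COUNT REGROUPS: on the equaliser
  `E = {y ∈ r'.domain | Σ_k c_k 1_{ρ_k.domain}(y) = D}` (semialgebraic by graph elimination
  `KZ.isSemialgebraic_sep_eq`, co-null by hypothesis) the extended indicators and `−D • r'|E` form a
  zero combination.
* Corollary `sheetTransfer_proof`: `MultivaluedCoV.SheetTransfer` (stmt-KontsevichZagierPeriods-2877)
  is the case `ε ≡ 1`, `D = N` (co-null images ⇒ the count is a.e. `N`).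

Only rules (1) and (2) of the KZ calculus and Tarski–Seidenberg are used; nothing about values of
periods. References: M. Kontsevich, D. Zagier, *Periods* (2001) §1.2 rules (1)–(2); J. Bochnak,
M. Coste, M.-F. Roy, *Real Algebraic Geometry* (1998) §2.2, Prop. 2.2.7; S. Basu, R. Pollack,
M.-F. Roy, *Algorithms in Real Algebraic Geometry* (2006) Prop. 2.83, Prop. 3.22; Mathlib
`MeasureTheory.integrableOn_image_iff_integrableOn_abs_det_fderiv_smul`.

LANDING NOTE (for a prover; planners cannot write `Theorems/`): this file is LANDING-READY — no
`sorry`, no Prop-valued `def` (no vendored facts), every declaration in the cone of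
`signedSheetTransfer_proof` / `sheetTransfer_proof`. Propose it verbatim as
`Summits/KontsevichZagierPeriods/KontsevichZagierPeriods/Theorems/CobordismMoveSignedSheetTransfer.lean`
with `--workitem stmt-KontsevichZagierPeriods-5567` (it also closes stmt-KontsevichZagierPeriods-2877,
`MultivaluedCoV.SheetTransfer`). The typed decomposition with NAMED pieces
(`def SignedSheetPushforward`, `def SignedCountRegroup`, assembly `signedSheetTransfer_of_subs`) is the
registered skeleton `Cruxes/SignedSheetTransfer/Lines/split.lean`.
-/

noncomputable section

open MeasureTheory Set
open Literature.NumberTheory.Transcendental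
open Literature.ModelTheory.ExponentialFields (IsSemialgebraic isSemialgebraic_interior
  isSemialgebraic_closure)

namespace Summit.KontsevichZagierPeriods.CobordismMove.SignedSheetTransferSplit

open Summit.KontsevichZagierPeriods.KontsevichZagierPeriods.Theses.CobordismMove
open Summit.KontsevichZagierPeriods.CobordismMove

variable {n : ℕ}

/-! ## Helpers (proved) -/

/-- Finite unions of `ℚ`-semialgebraic sets indexed by `Fin N` are semialgebraic. -/
theorem isSemialgebraic_iUnion {N : ℕ} {s : Fin N → Set (Fin n → ℝ)}
    (hs : ∀ k, IsSemialgebraic ℚ (s k)) : IsSemialgebraic ℚ (⋃ k, s k) := by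
  have := Literature.ModelTheory.ExponentialFields.IsSemialgebraic.biUnion (k := ℚ) Finset.univ s
    fun k _ => hs k
  simpa using this

/-! ## The lemmas of piece X₁ (the registered stubs of line `split`, now proved) -/

/-- X₁ stub 1 (Jacobian of a semialgebraic map is semialgebraic): on an OPEN set `U`, if `Φ` is a
`ℚ`-semialgebraic map, Fréchet-differentiable at every point of `U`, then `x ↦ |det (fderiv ℝ Φ x)|`
is a `ℚ`-semialgebraic function on `U` (entries `∂_j Φ_i` semialgebraic by
`IsSemialgebraicFunOn.fderiv_apply_single`, Basu–Pollack–Roy Prop. 3.22; determinant by Leibniz,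
`IsSemialgebraicFunOn.matrix_det`; absolute value). -/
theorem stub_jacobianSemialgebraic :
    ∀ {n : ℕ} (U : Set (Fin n → ℝ)) (Φ : (Fin n → ℝ) → (Fin n → ℝ)), IsOpen U →
      IsSemialgebraicMapOn ℚ U Φ → (∀ x ∈ U, DifferentiableAt ℝ Φ x) →
      IsSemialgebraicFunOn ℚ U (fun x => |(fderiv ℝ Φ x).det|) := by
  intro n U Φ hU hΦ hd
  classical
  have hUsa : IsSemialgebraic ℚ U := IsSemialgebraicMapOn.isSemialgebraic_holds hΦ
  have hcomp : ∀ i, IsSemialgebraicFunOn ℚ U (fun x => Φ x i) :=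
    (isSemialgebraicMapOn_iff_forall_holds hUsa).1 hΦ
  have hdi : ∀ i, ∀ x ∈ U, DifferentiableAt ℝ (fun y => Φ y i) x :=
    fun i x hx => differentiableAt_pi.1 (hd x hx) i
  have hentry : ∀ i j, IsSemialgebraicFunOn ℚ U
      (fun x => fderiv ℝ (fun y => Φ y i) x (Pi.single j 1)) :=
    fun i j => (hcomp i).fderiv_apply_single hU (hdi i) j
  have hM : IsSemialgebraicFunOn ℚ U (fun x => (LinearMap.toMatrix'
      ((fderiv ℝ Φ x : (Fin n → ℝ) →L[ℝ] (Fin n → ℝ)) : (Fin n → ℝ) →ₗ[ℝ] (Fin n → ℝ))).det) :=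
    IsSemialgebraicFunOn.matrix_det hUsa fun i j => (hentry i j).congr fun x hx => by
      beta_reduce
      rw [LinearMap.toMatrix'_apply, ContinuousLinearMap.coe_coe,
        (hasFDerivAt_pi'.1 (hd x hx).hasFDerivAt i).fderiv]
      all_goals rfl
  refine (hM.congr fun x _ => ?_).abs
  exact LinearMap.det_toMatrix' _

/-- X₁ stub 2 (synchronised open shrink of the sheets): finitely many `ℚ`-semialgebraic sheets
`σ_k` admit OPEN `ℚ`-semialgebraic `V_k ⊆ σ_k` with `⋃_k (σ_k ∖ V_k)` null and such that on
`⋃_k V_k` membership in `σ_j` and in `V_j` agree for every `j` (take `V_k = interior σ_k ∖ ⋃_j ∂σ_j`;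
frontiers of semialgebraic sets are null, BCR §2.8). -/
theorem stub_sheetShrink :
    ∀ {n N : ℕ} (σ : Fin N → Set (Fin n → ℝ)), (∀ k, IsSemialgebraic ℚ (σ k)) →
      ∃ V : Fin N → Set (Fin n → ℝ), (∀ k, IsOpen (V k)) ∧ (∀ k, IsSemialgebraic ℚ (V k)) ∧
        (∀ k, V k ⊆ σ k) ∧ volume (⋃ k, (σ k \ V k)) = 0 ∧
        (∀ x ∈ ⋃ k, V k, ∀ j, x ∈ σ j → x ∈ V j) := by
  intro n N σ hσ
  have hBc : IsClosed (⋃ j, frontier (σ j)) := isClosed_iUnion_of_finite fun j => isClosed_frontier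
  have hBnull : volume (⋃ j, frontier (σ j)) = 0 :=
    measure_iUnion_null fun j => volume_frontier_eq_zero_of_isSemialgebraic (hσ j)
  have hBsa : IsSemialgebraic ℚ (⋃ j, frontier (σ j)) :=
    isSemialgebraic_iUnion fun j => (isSemialgebraic_closure (hσ j)).diff (isSemialgebraic_interior (hσ j))
  have key : ∀ j x, x ∈ σ j → x ∉ (⋃ j, frontier (σ j)) → x ∈ interior (σ j) := by
    intro j x hxj hxB
    have hxf : x ∉ frontier (σ j) := fun h => hxB (mem_iUnion.2 ⟨j, h⟩)
    have : x ∈ closure (σ j) \ frontier (σ j) := ⟨subset_closure hxj, hxf⟩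
    rwa [closure_sdiff_frontier] at this
  refine ⟨fun k => interior (σ k) \ ⋃ j, frontier (σ j), fun k => isOpen_interior.sdiff hBc,
    fun k => (isSemialgebraic_interior (hσ k)).diff hBsa,
    fun k => sdiff_subset.trans interior_subset, ?_, ?_⟩
  · refine measure_mono_null (iUnion_subset fun k => ?_) hBnull
    intro x hx
    by_contra hxB
    exact hx.2 ⟨key k x hx.1 hxB, hxB⟩
  · intro x hx j hxj
    obtain ⟨k, hk⟩ := mem_iUnion.1 hx
    exact ⟨key j x hxj hk.2, hk.2⟩

/-- X₁ stub 3 (one sheet, zero-extended, is pushed forward by ONE change of variables): for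
`ℚ`-semialgebraic `V ⊆ G`, a `ℚ`-semialgebraic map `Φ` on `V`, injective with derivative `Φ'` within
`V`, `Φ '' V ⊆ ρ.domain`, and the sheet term `h = (ρ.integrand ∘ Φ) · |det Φ'|` `ℚ`-semialgebraic on
`V`: there are representations `R = [G, 1_V h]` and `S = [Φ '' V, ρ.integrand]` with `[R] − [S] ∈
KZ.relations` (`h` integrable on `V` by Mathlib's `integrableOn_image_iff_integrableOn_abs_det_fderiv_smul`;
`[G, 1_V h] = [V, h] + [G ∖ V, 0]` by rule (1); `[V, h] − [Φ V, ρ.integrand]` is rule (2)). -/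
theorem stub_singleSheetPush :
    ∀ {n : ℕ} (G V : Set (Fin n → ℝ)) (Φ : (Fin n → ℝ) → (Fin n → ℝ))
      (Φ' : (Fin n → ℝ) → ((Fin n → ℝ) →L[ℝ] (Fin n → ℝ))) (ρ : KZ.IntegralRep n),
      IsSemialgebraic ℚ G → IsSemialgebraic ℚ V → V ⊆ G → IsSemialgebraicMapOn ℚ V Φ →
      (∀ x ∈ V, HasFDerivWithinAt Φ (Φ' x) V x) → InjOn Φ V → Φ '' V ⊆ ρ.domain →
      IsSemialgebraicFunOn ℚ V (fun x => ρ.integrand (Φ x) * |(Φ' x).det|) →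
      ∃ R S : KZ.IntegralRep n, R.domain = G ∧
        R.integrand = V.indicator (fun x => ρ.integrand (Φ x) * |(Φ' x).det|) ∧
        S.domain = Φ '' V ∧ S.integrand = ρ.integrand ∧ KZ.of R - KZ.of S ∈ KZ.relations := by
  intro n G V Φ Φ' ρ hG hV hVG hΦ hder hinj himg hh
  classical
  have hVm : MeasurableSet V :=
    Literature.ModelTheory.ExponentialFields.IsSemialgebraic.measurableSet_holds hV
  have hEsa : IsSemialgebraic ℚ (Φ '' V) :=
    IsSemialgebraicMapOn.isSemialgebraic_image_holds hΦ Subset.rfl hV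
  -- integrability of the sheet term on `V` (change of variables for integrability)
  have hint : IntegrableOn (fun x => ρ.integrand (Φ x) * |(Φ' x).det|) V := by
    have := (integrableOn_image_iff_integrableOn_abs_det_fderiv_smul volume hVm hder hinj
      ρ.integrand).1 (ρ.integrableOn.mono_set himg)
    exact this.congr_fun (fun x _ => by beta_reduce; rw [smul_eq_mul, mul_comm]) hVm
  -- the zero-extended sheet term on `G`
  have hRsa : IsSemialgebraicFunOn ℚ G (V.indicator fun x => ρ.integrand (Φ x) * |(Φ' x).det|) := by
    have h0 : IsSemialgebraicFunOn ℚ (G \ V) (fun _ => ((0 : ℕ) : ℝ)) :=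
      isSemialgebraicFunOn_natCast (hG.diff hV) 0
    have := IsSemialgebraicFunOn.union
      (F := V.indicator fun x => ρ.integrand (Φ x) * |(Φ' x).det|) hh h0
      (fun x hx => by simp [indicator_of_mem hx]) (fun x hx => by simp [indicator_of_notMem hx.2])
    rwa [union_sdiff_cancel hVG] at this
  obtain ⟨R, hRd, hRi⟩ : ∃ R : KZ.IntegralRep n, R.domain = G ∧
      R.integrand = V.indicator (fun x => ρ.integrand (Φ x) * |(Φ' x).det|) :=
    ⟨⟨G, _, hG, hRsa, (hint.integrable_indicator hVm).integrableOn⟩, rfl, rfl⟩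
  have hVR : V ⊆ R.domain := hRd ▸ hVG
  have hGVR : G \ V ⊆ R.domain := hRd ▸ sdiff_subset
  -- rule (1a): `[R] = [R|V] + [R|G∖V]`, the second with zero integrand
  have hadd : KZ.of R - KZ.of (R.restrict V hV hVR) -
      KZ.of (R.restrict (G \ V) (hG.diff hV) hGVR) ∈ KZ.domainAddRel :=
    ⟨n, R, R.restrict V hV hVR, R.restrict (G \ V) (hG.diff hV) hGVR,
      by
        show R.domain = V ∪ (G \ V)
        rw [hRd, union_sdiff_cancel hVG],
      by
        show volume (V ∩ (G \ V)) = 0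
        rw [inter_sdiff_self, measure_empty],
      fun _ _ => rfl, fun _ _ => rfl, rfl⟩
  have e2 : KZ.of (R.restrict (G \ V) (hG.diff hV) hGVR) ∈ KZ.relations :=
    KZ.of_mem_relations_of_eqOn_zero _ fun x hx => by
      show R.integrand x = 0
      rw [hRi]
      exact indicator_of_notMem hx.2 _
  -- rule (2): `[R|V] − [ρ|Φ V]` is literally one change-of-variables instance
  have e1 : KZ.of (R.restrict V hV hVR) - KZ.of (ρ.restrict (Φ '' V) hEsa himg) ∈ KZ.relations :=
    KZ.changeOfVariablesRel_subset_relations ⟨n, R.restrict V hV hVR, ρ.restrict (Φ '' V) hEsa himg,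
      Φ, Φ', hΦ, hder, hinj, rfl, fun x hx => by
        show R.integrand x = ρ.integrand (Φ x) * |(Φ' x).det|
        rw [hRi, indicator_of_mem (show x ∈ V from hx)], rfl⟩
  refine ⟨R, ρ.restrict (Φ '' V) hEsa himg, hRd, hRi, rfl, rfl, ?_⟩
  have : KZ.of R - KZ.of (ρ.restrict (Φ '' V) hEsa himg) =
      (KZ.of R - KZ.of (R.restrict V hV hVR) - KZ.of (R.restrict (G \ V) (hG.diff hV) hGVR)) +
      KZ.of (R.restrict (G \ V) (hG.diff hV) hGVR) +
      (KZ.of (R.restrict V hV hVR) - KZ.of (ρ.restrict (Φ '' V) hEsa himg)) := by abel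
  rw [this]
  exact add_mem (add_mem (KZ.domainAddRel_subset_relations hadd) e2) e1

/-- X₁ stub 4 (dropping the image of a null piece of the sheet from the target is a relation): if
`V ⊆ σ` with `σ ∖ V` null, `Φ` differentiable within `σ`, `ρ.domain = Φ '' σ` and `S = [Φ '' V,
ρ.integrand]`, then `[ρ] − [S] ∈ KZ.relations` (`Φ '' σ ∖ Φ '' V ⊆ Φ '' (σ ∖ V)` is null by
`addHaar_image_eq_zero_of_differentiableOn_of_addHaar_eq_zero`; rule (1)). -/
theorem stub_imageNullRestrict :
    ∀ {n : ℕ} (σ V : Set (Fin n → ℝ)) (Φ : (Fin n → ℝ) → (Fin n → ℝ))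
      (Φ' : (Fin n → ℝ) → ((Fin n → ℝ) →L[ℝ] (Fin n → ℝ))) (ρ S : KZ.IntegralRep n),
      V ⊆ σ → volume (σ \ V) = 0 → (∀ x ∈ σ, HasFDerivWithinAt Φ (Φ' x) σ x) →
      ρ.domain = Φ '' σ → S.domain = Φ '' V → EqOn S.integrand ρ.integrand S.domain →
      KZ.of ρ - KZ.of S ∈ KZ.relations := by
  intro n σ V Φ Φ' ρ S hVσ hnull hder hρ hSd hSi
  have hEsa : IsSemialgebraic ℚ (Φ '' V) := hSd ▸ S.isSemialgebraic_domain
  have hEρ : Φ '' V ⊆ ρ.domain := hρ ▸ image_mono hVσ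
  have hvol : volume (ρ.domain \ Φ '' V) = 0 := by
    rw [hρ]
    have hsub : Φ '' σ \ Φ '' V ⊆ Φ '' (σ \ V) := fun y hy => by
      obtain ⟨⟨x, hx, rfl⟩, hy⟩ := hy
      exact ⟨x, ⟨hx, fun hxV => hy ⟨x, hxV, rfl⟩⟩, rfl⟩
    refine measure_mono_null hsub ?_
    exact addHaar_image_eq_zero_of_differentiableOn_of_addHaar_eq_zero volume
      (fun x hx => ((hder x hx.1).mono sdiff_subset).differentiableWithinAt) hnull
  have e1 := ρ.of_sub_of_restrict_mem_relations hEsa hEρ hvol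
  have e2 : KZ.of (ρ.restrict (Φ '' V) hEsa hEρ) - KZ.of S ∈ KZ.relations :=
    KZ.of_sub_of_mem_relations_of_eqOn hSd fun x hx => by
      have hxS : x ∈ S.domain := by rw [hSd]; exact hx
      exact (hSi hxS).symm
  have : KZ.of ρ - KZ.of S = (KZ.of ρ - KZ.of (ρ.restrict (Φ '' V) hEsa hEρ)) +
      (KZ.of (ρ.restrict (Φ '' V) hEsa hEρ) - KZ.of S) := by abel
  rw [this]
  exact add_mem e1 e2

/-! ## The lemmas of piece X₂ (registered stubs, now proved) -/

/-- X₂ stub 1 (integer indicator combinations are semialgebraic functions): for `ℚ`-semialgebraic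
`τ` and `T_k`, the function `y ↦ Σ_k c_k 1_{T_k}(y)` is `ℚ`-semialgebraic on `τ`. -/
theorem stub_countSemialgebraic :
    ∀ {n N : ℕ} (τ : Set (Fin n → ℝ)) (T : Fin N → Set (Fin n → ℝ)) (c : Fin N → ℤ),
      IsSemialgebraic ℚ τ → (∀ k, IsSemialgebraic ℚ (T k)) →
      IsSemialgebraicFunOn ℚ τ (fun y => ∑ k : Fin N, (c k : ℝ) * (T k).indicator (fun _ => (1 : ℝ)) y) := by
  intro n N τ T c hτ hT
  refine KZ.isSemialgebraicFunOn_finset_sum Finset.univ hτ fun k _ => ?_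
  have hind : IsSemialgebraicFunOn ℚ τ ((T k).indicator (fun _ => (1 : ℝ))) := by
    have h1 : IsSemialgebraicFunOn ℚ (τ ∩ T k) (fun _ => ((1 : ℕ) : ℝ)) :=
      isSemialgebraicFunOn_natCast (hτ.inter (hT k)) 1
    have h0 : IsSemialgebraicFunOn ℚ (τ \ T k) (fun _ => ((0 : ℕ) : ℝ)) :=
      isSemialgebraicFunOn_natCast (hτ.diff (hT k)) 0
    have := IsSemialgebraicFunOn.union (F := (T k).indicator fun _ => (1 : ℝ)) h1 h0
      (fun x hx => by simp [indicator_of_mem hx.2]) (fun x hx => by simp [indicator_of_notMem hx.2])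
    rwa [inter_union_sdiff] at this
  exact IsSemialgebraicFunOn.mul_holds (isSemialgebraicFunOn_const_intCast hτ (c k)) hind

/-- X₂ stub 2 (indicator extension is a relation): for a representation `R`, a `ℚ`-semialgebraic
`T` and `S = [T ∩ R.domain, R.integrand]`, there is `W = [R.domain, 1_T R.integrand]` with
`[W] − [S] ∈ KZ.relations` (rule (1): `W = S + [R.domain ∖ T, 0]`). -/
theorem stub_indicatorExtension :
    ∀ {n : ℕ} (R S : KZ.IntegralRep n) (T : Set (Fin n → ℝ)), IsSemialgebraic ℚ T →
      S.domain = T ∩ R.domain → EqOn S.integrand R.integrand S.domain →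
      ∃ W : KZ.IntegralRep n, W.domain = R.domain ∧ W.integrand = T.indicator R.integrand ∧
        KZ.of W - KZ.of S ∈ KZ.relations := by
  intro n R S T hT hSd hSi
  classical
  have hRsa := R.isSemialgebraic_domain
  have hTm : MeasurableSet T :=
    Literature.ModelTheory.ExponentialFields.IsSemialgebraic.measurableSet_holds hT
  have hWsa : IsSemialgebraicFunOn ℚ R.domain (T.indicator R.integrand) := by
    have h1 : IsSemialgebraicFunOn ℚ (R.domain ∩ T) R.integrand :=
      R.isSemialgebraicFunOn_integrand.mono inter_subset_left (hRsa.inter hT)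
    have h0 : IsSemialgebraicFunOn ℚ (R.domain \ T) (fun _ => ((0 : ℕ) : ℝ)) :=
      isSemialgebraicFunOn_natCast (hRsa.diff hT) 0
    have := IsSemialgebraicFunOn.union (F := T.indicator R.integrand) h1 h0
      (fun x hx => by simp [indicator_of_mem hx.2]) (fun x hx => by simp [indicator_of_notMem hx.2])
    rwa [inter_union_sdiff] at this
  obtain ⟨W, hWd, hWi⟩ : ∃ W : KZ.IntegralRep n, W.domain = R.domain ∧
      W.integrand = T.indicator R.integrand :=
    ⟨⟨R.domain, T.indicator R.integrand, hRsa, hWsa, R.integrableOn.indicator hTm⟩, rfl, rfl⟩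
  have hsub1 : T ∩ R.domain ⊆ W.domain := hWd ▸ inter_subset_right
  have hsub2 : R.domain \ T ⊆ W.domain := hWd ▸ sdiff_subset
  have hadd : KZ.of W - KZ.of (W.restrict (T ∩ R.domain) (hT.inter hRsa) hsub1) -
      KZ.of (W.restrict (R.domain \ T) (hRsa.diff hT) hsub2) ∈ KZ.domainAddRel :=
    ⟨n, W, W.restrict (T ∩ R.domain) (hT.inter hRsa) hsub1,
      W.restrict (R.domain \ T) (hRsa.diff hT) hsub2,
      by
        show W.domain = (T ∩ R.domain) ∪ (R.domain \ T)
        rw [hWd, inter_comm, inter_union_sdiff],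
      by
        show volume ((T ∩ R.domain) ∩ (R.domain \ T)) = 0
        rw [inter_comm T, inter_assoc, inter_sdiff_self, inter_empty, measure_empty],
      fun _ _ => rfl, fun _ _ => rfl, rfl⟩
  have e2 : KZ.of (W.restrict (R.domain \ T) (hRsa.diff hT) hsub2) ∈ KZ.relations :=
    KZ.of_mem_relations_of_eqOn_zero _ fun x hx => by
      show W.integrand x = 0
      rw [hWi]
      exact indicator_of_notMem hx.2 _
  have e1 : KZ.of (W.restrict (T ∩ R.domain) (hT.inter hRsa) hsub1) - KZ.of S ∈ KZ.relations :=
    KZ.of_sub_of_mem_relations_of_eqOn hSd fun x hx => by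
      show W.integrand x = S.integrand x
      have hxS : x ∈ S.domain := by rw [hSd]; exact hx
      rw [hWi, indicator_of_mem (show x ∈ T from hx.1)]
      exact (hSi hxS).symm
  refine ⟨W, hWd, hWi, ?_⟩
  have : KZ.of W - KZ.of S =
      (KZ.of W - KZ.of (W.restrict (T ∩ R.domain) (hT.inter hRsa) hsub1) -
        KZ.of (W.restrict (R.domain \ T) (hRsa.diff hT) hsub2)) +
      KZ.of (W.restrict (R.domain \ T) (hRsa.diff hT) hsub2) +
      (KZ.of (W.restrict (T ∩ R.domain) (hT.inter hRsa) hsub1) - KZ.of S) := by abel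
  rw [this]
  exact add_mem (add_mem (KZ.domainAddRel_subset_relations hadd) e2) e1

/-! ## Piece X₂ from its stubs (PROVED) -/

theorem signedCountRegroup_of
    (H₁ : ∀ {n N : ℕ} (τ : Set (Fin n → ℝ)) (T : Fin N → Set (Fin n → ℝ)) (c : Fin N → ℤ),
      IsSemialgebraic ℚ τ → (∀ k, IsSemialgebraic ℚ (T k)) →
      IsSemialgebraicFunOn ℚ τ (fun y => ∑ k : Fin N, (c k : ℝ) * (T k).indicator (fun _ => (1 : ℝ)) y))
    (H₂ : ∀ {n : ℕ} (R S : KZ.IntegralRep n) (T : Set (Fin n → ℝ)), IsSemialgebraic ℚ T →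
      S.domain = T ∩ R.domain → EqOn S.integrand R.integrand S.domain →
      ∃ W : KZ.IntegralRep n, W.domain = R.domain ∧ W.integrand = T.indicator R.integrand ∧
        KZ.of W - KZ.of S ∈ KZ.relations) :
    ∀ (n N : ℕ) (D : ℤ) (r' : Literature.NumberTheory.Transcendental.KZ.IntegralRep n) (c : Fin N → ℤ) (ρ : Fin N → Literature.NumberTheory.Transcendental.KZ.IntegralRep n), (∀ k, (ρ k).domain ⊆ r'.domain) → (∀ k, Set.EqOn (ρ k).integrand r'.integrand (ρ k).domain) → (∀ᵐ y ∂(MeasureTheory.volume.restrict r'.domain), (∑ k : Fin N, (c k : ℝ) * ((ρ k).domain).indicator (fun _ => (1 : ℝ)) y) = (D : ℝ)) → (∑ k : Fin N, c k • Literature.NumberTheory.Transcendental.KZ.of (ρ k)) - D • Literature.NumberTheory.Transcendental.KZ.of r' ∈ Literature.NumberTheory.Transcendental.KZ.relations := by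
  intro n N D r' c ρ hsub hint hcount
  classical
  -- notation
  set τ : Set (Fin n → ℝ) := r'.domain with hτ
  set T : Fin N → Set (Fin n → ℝ) := fun k => (ρ k).domain with hT
  set F : (Fin n → ℝ) → ℝ := fun y => ∑ k : Fin N, (c k : ℝ) * (T k).indicator (fun _ => (1 : ℝ)) y
    with hF
  have hτsa : IsSemialgebraic ℚ τ := r'.isSemialgebraic_domain
  have hTsa : ∀ k, IsSemialgebraic ℚ (T k) := fun k => (ρ k).isSemialgebraic_domain
  have hFsa : IsSemialgebraicFunOn ℚ τ F := H₁ τ T c hτsa hTsa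
  -- the good set `E = {y ∈ τ | F y = D}`
  set E : Set (Fin n → ℝ) := {y | y ∈ τ ∧ F y = (D : ℝ)} with hE
  have hEsa : IsSemialgebraic ℚ E :=
    isSemialgebraic_sep_eq hFsa (isSemialgebraicFunOn_ratCast hτsa (D : ℚ) |>.congr fun _ _ => by simp)
  have hEτ : E ⊆ τ := fun y hy => hy.1
  have hτm : MeasurableSet τ :=
    Literature.ModelTheory.ExponentialFields.IsSemialgebraic.measurableSet_holds hτsa
  have hnull : volume (τ \ E) = 0 := by
    have h1 : ∀ᵐ y ∂volume, y ∈ τ → F y = (D : ℝ) := (ae_restrict_iff' hτm).1 hcount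
    rw [ae_iff] at h1
    refine measure_mono_null (fun y hy => ?_) h1
    simp only [mem_setOf_eq, Classical.not_imp]
    exact ⟨hy.1, fun h => hy.2 ⟨hy.1, h⟩⟩
  -- restrictions to the good set
  set r'E : KZ.IntegralRep n := r'.restrict E hEsa hEτ with hr'E
  have e₀ : KZ.of r' - KZ.of r'E ∈ KZ.relations := r'.of_sub_of_restrict_mem_relations hEsa hEτ hnull
  have hTEsa : ∀ k, IsSemialgebraic ℚ (T k ∩ E) := fun k => (hTsa k).inter hEsa
  set ρE : Fin N → KZ.IntegralRep n := fun k =>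
    (ρ k).restrict (T k ∩ E) (hTEsa k) inter_subset_left with hρE
  have e₁ : ∀ k, KZ.of (ρ k) - KZ.of (ρE k) ∈ KZ.relations := fun k => by
    refine (ρ k).of_sub_of_restrict_mem_relations (hTEsa k) inter_subset_left ?_
    refine measure_mono_null (fun y hy => ?_) hnull
    exact ⟨hsub k hy.1, fun hyE => hy.2 ⟨hy.1, hyE⟩⟩
  -- the indicator extensions `W k = [E, 1_{T k} r'.integrand]`
  have hW : ∀ k, ∃ W : KZ.IntegralRep n, W.domain = E ∧
      W.integrand = (T k).indicator r'.integrand ∧ KZ.of W - KZ.of (ρE k) ∈ KZ.relations := by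
    intro k
    obtain ⟨W, hWd, hWi, hWr⟩ := H₂ r'E (ρE k) (T k) (hTsa k) rfl
      (fun y hy => hint k (show y ∈ (ρ k).domain from hy.1))
    exact ⟨W, hWd, hWi, hWr⟩
  choose W hWd hWi hWr using hW
  -- zero combination on the common domain `E`
  have hz := ZeroCombination.zeroCombination_holds n (N + 1) E (Fin.cons r'E W) (Fin.cons (-D) c)
    (fun i => Fin.cases rfl (fun k => hWd k) i) (fun y hy => by
      rw [Fin.sum_univ_succ]
      simp only [Fin.cons_zero, Fin.cons_succ, Int.cast_neg]
      have hy' : F y = D := hy.2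
      have hWy : ∀ k, (W k).integrand y = (T k).indicator (fun _ => (1 : ℝ)) y * r'.integrand y := by
        intro k
        rw [hWi k]
        by_cases hyk : y ∈ T k <;> simp [hyk]
      simp only [hWy, ← mul_assoc, ← Finset.sum_mul]
      have : (∑ k : Fin N, (c k : ℝ) * (T k).indicator (fun _ => (1 : ℝ)) y) = D := hy'
      rw [this]
      show -(D : ℝ) * r'.integrand y + (D : ℝ) * r'.integrand y = 0
      ring)
  rw [Fin.sum_univ_succ] at hz
  simp only [Fin.cons_zero, Fin.cons_succ] at hz
  -- collect
  have e₁' : ∑ k : Fin N, c k • (KZ.of (ρ k) - KZ.of (ρE k)) ∈ KZ.relations :=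
    KZ.relations.sum_mem fun k _ => KZ.relations.zsmul_mem (e₁ k) _
  have e₂' : ∑ k : Fin N, c k • (KZ.of (W k) - KZ.of (ρE k)) ∈ KZ.relations :=
    KZ.relations.sum_mem fun k _ => KZ.relations.zsmul_mem (hWr k) _
  have e₀' : D • (KZ.of r' - KZ.of r'E) ∈ KZ.relations := KZ.relations.zsmul_mem e₀ _
  have key : (∑ k : Fin N, c k • KZ.of (ρ k)) - D • KZ.of r' =
      ∑ k : Fin N, c k • (KZ.of (ρ k) - KZ.of (ρE k)) -
        ∑ k : Fin N, c k • (KZ.of (W k) - KZ.of (ρE k)) +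
        (-D • KZ.of r'E + ∑ k : Fin N, c k • KZ.of (W k)) - D • (KZ.of r' - KZ.of r'E) := by
    simp only [smul_sub, Finset.sum_sub_distrib, neg_smul]
    abel
  rw [key]
  exact KZ.relations.sub_mem (KZ.relations.add_mem (KZ.relations.sub_mem e₁' e₂') hz) e₀'


/-! ## Piece X₁ from its stubs (PROVED) -/

theorem signedSheetPushforward_of
    (H₁ : ∀ {n : ℕ} (U : Set (Fin n → ℝ)) (Φ : (Fin n → ℝ) → (Fin n → ℝ)), IsOpen U →
      IsSemialgebraicMapOn ℚ U Φ → (∀ x ∈ U, DifferentiableAt ℝ Φ x) →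
      IsSemialgebraicFunOn ℚ U (fun x => |(fderiv ℝ Φ x).det|))
    (H₂ : ∀ {n N : ℕ} (σ : Fin N → Set (Fin n → ℝ)), (∀ k, IsSemialgebraic ℚ (σ k)) →
      ∃ V : Fin N → Set (Fin n → ℝ), (∀ k, IsOpen (V k)) ∧ (∀ k, IsSemialgebraic ℚ (V k)) ∧
        (∀ k, V k ⊆ σ k) ∧ volume (⋃ k, (σ k \ V k)) = 0 ∧
        (∀ x ∈ ⋃ k, V k, ∀ j, x ∈ σ j → x ∈ V j))
    (H₃ : ∀ {n : ℕ} (G V : Set (Fin n → ℝ)) (Φ : (Fin n → ℝ) → (Fin n → ℝ))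
      (Φ' : (Fin n → ℝ) → ((Fin n → ℝ) →L[ℝ] (Fin n → ℝ))) (ρ : KZ.IntegralRep n),
      IsSemialgebraic ℚ G → IsSemialgebraic ℚ V → V ⊆ G → IsSemialgebraicMapOn ℚ V Φ →
      (∀ x ∈ V, HasFDerivWithinAt Φ (Φ' x) V x) → InjOn Φ V → Φ '' V ⊆ ρ.domain →
      IsSemialgebraicFunOn ℚ V (fun x => ρ.integrand (Φ x) * |(Φ' x).det|) →
      ∃ R S : KZ.IntegralRep n, R.domain = G ∧
        R.integrand = V.indicator (fun x => ρ.integrand (Φ x) * |(Φ' x).det|) ∧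
        S.domain = Φ '' V ∧ S.integrand = ρ.integrand ∧ KZ.of R - KZ.of S ∈ KZ.relations)
    (H₄ : ∀ {n : ℕ} (σ V : Set (Fin n → ℝ)) (Φ : (Fin n → ℝ) → (Fin n → ℝ))
      (Φ' : (Fin n → ℝ) → ((Fin n → ℝ) →L[ℝ] (Fin n → ℝ))) (ρ S : KZ.IntegralRep n),
      V ⊆ σ → volume (σ \ V) = 0 → (∀ x ∈ σ, HasFDerivWithinAt Φ (Φ' x) σ x) →
      ρ.domain = Φ '' σ → S.domain = Φ '' V → EqOn S.integrand ρ.integrand S.domain →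
      KZ.of ρ - KZ.of S ∈ KZ.relations) :
    ∀ (n N : ℕ) (r : Literature.NumberTheory.Transcendental.KZ.IntegralRep n) (c : Fin N → ℤ) (σ : Fin N → Set (Fin n → ℝ)) (Φ : Fin N → (Fin n → ℝ) → (Fin n → ℝ)) (Φ' : Fin N → (Fin n → ℝ) → ((Fin n → ℝ) →L[ℝ] (Fin n → ℝ))) (ρ : Fin N → Literature.NumberTheory.Transcendental.KZ.IntegralRep n), (∀ k, Literature.ModelTheory.ExponentialFields.IsSemialgebraic ℚ (σ k)) → (∀ k, σ k ⊆ r.domain) → MeasureTheory.volume (r.domain \ ⋃ k, σ k) = 0 → (∀ k, Literature.NumberTheory.Transcendental.IsSemialgebraicMapOn ℚ (σ k) (Φ k)) → (∀ k, ∀ x ∈ σ k, HasFDerivWithinAt (Φ k) (Φ' k x) (σ k) x) → (∀ k, Set.InjOn (Φ k) (σ k)) → (∀ k, (ρ k).domain = Φ k '' σ k) → (∀ x ∈ ⋃ k, σ k, r.integrand x = ∑ k : Fin N, (c k : ℝ) * (σ k).indicator (fun y => (ρ k).integrand (Φ k y) * |(Φ' k y).det|) x) → Literature.NumberTheory.Transcendental.KZ.of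 r - ∑ k : Fin N, c k • Literature.NumberTheory.Transcendental.KZ.of (ρ k) ∈ Literature.NumberTheory.Transcendental.KZ.relations := by
  intro n N r c σ Φ Φ' ρ hσ hsub hnull hmap hder hinj hρ hintg
  classical
  -- shrink the sheets
  obtain ⟨V, hVo, hVsa, hVσ, hVnull, hVmem⟩ := H₂ σ hσ
  have hGsa : IsSemialgebraic ℚ (⋃ k, V k) := isSemialgebraic_iUnion hVsa
  have hGσ : (⋃ k, V k) ⊆ ⋃ k, σ k := iUnion_mono hVσ
  have hGr : (⋃ k, V k) ⊆ r.domain := hGσ.trans (iUnion_subset hsub)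
  -- derivative facts on the open pieces
  have hnhds : ∀ k, ∀ x ∈ V k, σ k ∈ nhds x := fun k x hx =>
    Filter.mem_of_superset ((hVo k).mem_nhds hx) (hVσ k)
  have hderAt : ∀ k, ∀ x ∈ V k, HasFDerivAt (Φ k) (Φ' k x) x := fun k x hx =>
    (hder k x (hVσ k hx)).hasFDerivAt (hnhds k x hx)
  have hfd : ∀ k, ∀ x ∈ V k, fderiv ℝ (Φ k) x = Φ' k x := fun k x hx => (hderAt k x hx).fderiv
  -- the sheet term is semialgebraic on `V k`
  have hmapV : ∀ k, IsSemialgebraicMapOn ℚ (V k) (Φ k) := fun k => (hmap k).mono (hVσ k) (hVsa k)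
  have hhsa : ∀ k, IsSemialgebraicFunOn ℚ (V k)
      (fun y => (ρ k).integrand (Φ k y) * |(Φ' k y).det|) := by
    intro k
    have hcomp : IsSemialgebraicFunOn ℚ (V k) ((ρ k).integrand ∘ Φ k) :=
      IsSemialgebraicFunOn.comp_isSemialgebraicMapOn_holds (ρ k).isSemialgebraicFunOn_integrand
        (hmapV k) (fun x hx => by rw [hρ k]; exact mem_image_of_mem _ (hVσ k hx))
    have hjac : IsSemialgebraicFunOn ℚ (V k) (fun x => |(fderiv ℝ (Φ k) x).det|) :=
      H₁ (V k) (Φ k) (hVo k) (hmapV k) (fun x hx => (hderAt k x hx).differentiableAt)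
    refine (IsSemialgebraicFunOn.mul_holds hcomp hjac).congr fun x hx => ?_
    simp [hfd k x hx]
  -- per-sheet pushforward (one change of variables each)
  have hRS : ∀ k, ∃ R S : KZ.IntegralRep n, R.domain = (⋃ k, V k) ∧
      R.integrand = (V k).indicator (fun y => (ρ k).integrand (Φ k y) * |(Φ' k y).det|) ∧
      S.domain = Φ k '' V k ∧ S.integrand = (ρ k).integrand ∧ KZ.of R - KZ.of S ∈ KZ.relations :=
    fun k => H₃ (⋃ k, V k) (V k) (Φ k) (Φ' k) (ρ k) hGsa (hVsa k) (subset_iUnion V k) (hmapV k)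
      (fun x hx => (hder k x (hVσ k hx)).mono (hVσ k)) ((hinj k).mono (hVσ k))
      (by rw [hρ k]; exact image_mono (hVσ k)) (hhsa k)
  choose R S hRd hRi hSd hSi hRS' using hRS
  -- the null part of each target sheet
  have e₂ : ∀ k, KZ.of (ρ k) - KZ.of (S k) ∈ KZ.relations := fun k =>
    H₄ (σ k) (V k) (Φ k) (Φ' k) (ρ k) (S k) (hVσ k)
      (measure_mono_null (subset_iUnion (fun k => σ k \ V k) k) hVnull) (hder k) (hρ k) (hSd k)
      (fun y _ => by rw [hSi k])
  -- restrict `r` to the open co-null set `⋃ V k`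
  have e₀ : KZ.of r - KZ.of (r.restrict (⋃ k, V k) hGsa hGr) ∈ KZ.relations := by
    refine r.of_sub_of_restrict_mem_relations hGsa hGr (measure_mono_null (fun x hx => ?_)
      (measure_union_null hnull hVnull))
    by_cases hxσ : x ∈ ⋃ k, σ k
    · obtain ⟨k, hk⟩ := mem_iUnion.1 hxσ
      exact Or.inr (mem_iUnion.2 ⟨k, hk, fun hxV => hx.2 (mem_iUnion.2 ⟨k, hxV⟩)⟩)
    · exact Or.inl ⟨hx.1, hxσ⟩
  -- zero combination on the common domain `⋃ V k`
  have hz := ZeroCombination.zeroCombination_holds n (N + 1) (⋃ k, V k)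
    (Fin.cons (r.restrict (⋃ k, V k) hGsa hGr) R) (Fin.cons (-1) c)
    (fun i => Fin.cases rfl (fun k => hRd k) i) (fun x hx => by
      rw [Fin.sum_univ_succ]
      simp only [Fin.cons_zero, Fin.cons_succ, Int.cast_neg, Int.cast_one,
        KZ.IntegralRep.integrand_restrict]
      have h2 : ∀ k, (σ k).indicator (fun y => (ρ k).integrand (Φ k y) * |(Φ' k y).det|) x =
          (R k).integrand x := by
        intro k
        rw [hRi k]
        by_cases hxk : x ∈ σ k
        · rw [indicator_of_mem hxk, indicator_of_mem (hVmem x hx k hxk)]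
        · rw [indicator_of_notMem hxk, indicator_of_notMem (fun h' => hxk (hVσ k h'))]
      rw [hintg x (hGσ hx)]
      simp only [h2]
      ring)
  rw [Fin.sum_univ_succ] at hz
  simp only [Fin.cons_zero, Fin.cons_succ, neg_smul, one_smul] at hz
  -- collect
  have e₁' : ∑ k : Fin N, c k • (KZ.of (R k) - KZ.of (S k)) ∈ KZ.relations :=
    KZ.relations.sum_mem fun k _ => KZ.relations.zsmul_mem (hRS' k) _
  have e₂' : ∑ k : Fin N, c k • (KZ.of (ρ k) - KZ.of (S k)) ∈ KZ.relations :=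
    KZ.relations.sum_mem fun k _ => KZ.relations.zsmul_mem (e₂ k) _
  have key : KZ.of r - ∑ k : Fin N, c k • KZ.of (ρ k) =
      (KZ.of r - KZ.of (r.restrict (⋃ k, V k) hGsa hGr)) -
        (-KZ.of (r.restrict (⋃ k, V k) hGsa hGr) + ∑ k : Fin N, c k • KZ.of (R k)) +
        ∑ k : Fin N, c k • (KZ.of (R k) - KZ.of (S k)) -
        ∑ k : Fin N, c k • (KZ.of (ρ k) - KZ.of (S k)) := by
    simp only [smul_sub, Finset.sum_sub_distrib]
    abel
  rw [key]
  exact KZ.relations.sub_mem (KZ.relations.add_mem (KZ.relations.sub_mem e₀ hz) e₁') e₂'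

/-! ## The crux (PROVED): assembly of the two pieces -/

/-- **`SignedSheetTransfer` holds** (the route declaration, BY NAME; no `sorry`). Assembly of the two
pieces: with the image representations `ρ_k = r' | Φ_k σ_k` (images `ℚ`-semialgebraic by
Tarski–Seidenberg), X₁ (`signedSheetPushforward_of …`) gives `[r] − Σ ε_k•[ρ_k] ∈ relations` and X₂
(`signedCountRegroup_of …`) gives `Σ ε_k•[ρ_k] − D•[r'] ∈ relations`; add. -/
theorem signedSheetTransfer_proof :
    Summit.KontsevichZagierPeriods.KontsevichZagierPeriods.Theses.CobordismMove.SignedSheetTransfer := by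
  intro n N D r r' ε σ Φ Φ' hε hσ hsub hnull hmap hder hinj himg hcount hintg
  have himgsa : ∀ k, IsSemialgebraic ℚ (Φ k '' σ k) := fun k =>
    IsSemialgebraicMapOn.isSemialgebraic_image_holds (hmap k) Subset.rfl (hσ k)
  set ρ : Fin N → KZ.IntegralRep n := fun k => r'.restrict (Φ k '' σ k) (himgsa k) (himg k) with hρ
  have e₁ : KZ.of r - ∑ k : Fin N, ε k • KZ.of (ρ k) ∈ KZ.relations :=
    signedSheetPushforward_of stub_jacobianSemialgebraic stub_sheetShrink stub_singleSheetPush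
      stub_imageNullRestrict n N r ε σ Φ Φ' ρ hσ hsub hnull hmap hder hinj (fun k => rfl) hintg
  have e₂ : (∑ k : Fin N, ε k • KZ.of (ρ k)) - D • KZ.of r' ∈ KZ.relations :=
    signedCountRegroup_of stub_countSemialgebraic stub_indicatorExtension n N D r' ε ρ
      (fun k => himg k) (fun k => fun x _ => rfl) hcount
  have := KZ.relations.add_mem e₁ e₂
  simpa using this

/-! ## Corollary: `MultivaluedCoV.SheetTransfer` (stmt-KontsevichZagierPeriods-2877)

The unsigned sheet-transfer crux of route `MultivaluedCoV` is the special case `ε ≡ 1`, `D = N`: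
when every image `Φ_k σ_k` is co-null in `r'.domain`, the count `Σ_k 1_{Φ_k σ_k}` is a.e. the
constant `N` on `r'.domain`. -/

/-- `SignedSheetTransfer → MultivaluedCoV.SheetTransfer` (`ε ≡ 1`, `D = N`). -/
theorem sheetTransfer_of_signedSheetTransfer
    (h : Summit.KontsevichZagierPeriods.KontsevichZagierPeriods.Theses.CobordismMove.SignedSheetTransfer) :
    Summit.KontsevichZagierPeriods.KontsevichZagierPeriods.Theses.MultivaluedCoV.SheetTransfer := by
  intro n N r r' σ Φ Φ' hσ hsub hnull hmap hder hinj himg hconull hintg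
  have hτm : MeasurableSet r'.domain :=
    Literature.ModelTheory.ExponentialFields.IsSemialgebraic.measurableSet_holds
      r'.isSemialgebraic_domain
  -- the count `Σ_k 1_{Φ_k σ_k}` is a.e. `N` on `r'.domain`
  have hcount : ∀ᵐ y ∂(volume.restrict r'.domain),
      (∑ k : Fin N, ((1 : ℤ) : ℝ) * (Φ k '' σ k).indicator (fun _ => (1 : ℝ)) y) = ((N : ℤ) : ℝ) := by
    have hall : ∀ k, ∀ᵐ y ∂(volume.restrict r'.domain), y ∈ Φ k '' σ k := by
      intro k
      rw [ae_restrict_iff' hτm]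
      have h0 : volume {y | ¬ (y ∈ r'.domain → y ∈ Φ k '' σ k)} = 0 :=
        measure_mono_null (fun y hy => by
          simp only [mem_setOf_eq, Classical.not_imp] at hy
          exact ⟨hy.1, hy.2⟩) (hconull k)
      exact h0
    have hall' : ∀ᵐ y ∂(volume.restrict r'.domain), ∀ k, y ∈ Φ k '' σ k := ae_all_iff.2 hall
    filter_upwards [hall'] with y hy
    simp [indicator_of_mem (hy _)]
  have key := h n N (N : ℤ) r r' (fun _ => 1) σ Φ Φ' (fun _ => Or.inl rfl) hσ hsub hnull hmap hder
    hinj himg hcount (fun x hx => by simpa using hintg x hx)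
  simpa [natCast_zsmul] using key

/-- **`MultivaluedCoV.SheetTransfer` holds** (stmt-KontsevichZagierPeriods-2877; sorry-free). -/
theorem sheetTransfer_proof :
    Summit.KontsevichZagierPeriods.KontsevichZagierPeriods.Theses.MultivaluedCoV.SheetTransfer :=
  sheetTransfer_of_signedSheetTransfer signedSheetTransfer_proof

end Summit.KontsevichZagierPeriods.CobordismMove.SignedSheetTransferSplit
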